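import Literature.NumberTheory.Automorphic.AutomorphicInductionCharacterCubic
import Literature.NumberTheory.Automorphic.AutomorphicInductionUnitaryCharacterCubic
import Literature.NumberTheory.Automorphic.GLOneOfHeckeCharacterBJ
import Literature.NumberTheory.Automorphic.GLnAdelicStructureProofs
import HarnessLib

/-!
# Non-normal cubic automorphic induction of a finite-order Hecke character: reduction to the
# unitary fact, and the fact in the vocabulary of Arthur–Clozel's Definition 6.1 (proofs)

Topic `NumberTheory/Automorphic`; a proof file (theorems only: no definition, no named fact, no
instance) for the named fact
`Literature.NumberTheory.Automorphic.automorphicInduction_character_cubic` of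
`AutomorphicInductionCharacterCubic` (Jacquet–Piatetski-Shapiro–Shalika 1979, §§13–14; Gelbart
1997, Thm. 5.3.1 with Remark 5.3.1 (e): automorphic induction of a Hecke character `θ` of finite
order of a cubic, not necessarily Galois, extension `E/F` to a cuspidal representation of
`GL₃(𝔸_F)` with `L(s, π(θ)_v) = ∏_{w ∣ v} L(s, θ_w)` at almost every `v`).

* `automorphicInduction_character_cubic_of_unitaryCharacter` — **the finite-order fact is the
  finite-order case of the unitary fact** `automorphicInduction_unitaryCharacter_cubic`
  (`AutomorphicInductionUnitaryCharacterCubic`: the same printed theorem vendored for every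
  *unitary* `θ`, whose cuspidality clause (2) is verbatim the hypothesis-and-conclusion of the
  finite-order fact): finite-order Hecke characters are unitary
  (`HeckeCharacter.IsFiniteOrder.isUnitary`).  This is the complete reduction of the fact to one
  named leaf of the tree: `automorphicInduction_character_cubic_holds` is this theorem applied to a
  (future) `automorphicInduction_unitaryCharacter_cubic_holds`, whose content is the
  almost-everywhere converse theorem for `GL(3)` (op. cit. §13) applied to the Hecke `L`-functions
  `L(s, θ · (ω ∘ N_{E/F}))` (§14) — a theory with no carrier in Mathlib or the tree.
* `isAutomorphicInductionAlong_iff_of_hasSatakeParamAt_singleton` — **Def. 6.1 for `n = 1` is the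
  character identity**: if `τ` on `GL₁(𝔸_E)` has Satake parameter `{θ(ϖ_w)}` at almost every `w`,
  then for every `π` on `GL_N(𝔸_F)`, `IsAutomorphicInductionAlong τ π` (`BaseChangeInductionAlong`:
  Arthur–Clozel 1989, Ch. 3, Def. 6.1 with (6.1)–(6.2), "`t_{π_F,v}` is the multiset of
  `f(w|v)`-th roots of the entries of the `t_{π_E,w}`, `w ∣ v`") iff for almost every `v`, `π` has
  a Satake parameter `α` at `v` with `P_α = ∏_{w ∣ v} (X^{f(w|v)} - θ(ϖ_w))`, the explicit local
  identity of the character facts (any `E/F`, any `N`; the bridge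
  `finprod_under_eq_inducedSatakePolynomial` of `AutomorphicInductionUnitaryCharacterCubic`,
  uniqueness of Satake parameters `AutomorphicRepData.hasSatakeParamAt_unique_holds`, and the
  finite-fibred push-down `eventually_forall_under_eq`).
* `exists_automorphicRepData_hasSatakeParamAt_valueAtUniformizer` — the Borel–Jacquet-model
  representation `π_θ = ℂ·(θ∘det)/⊥` of `GL₁(𝔸_E)` (`exists_automorphicRepData_detTwist_glOne`,
  `AutomorphicRepData.hasSatakeParamAt_detTwist_glOne` of `GLOneOfHeckeCharacterBJ`) has Satake
  parameter `{θ(ϖ_w)}` (`HeckeCharacter.valueAtUniformizer`, the tree's chosen uniformizers) at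
  every `w` off a level of `θ` (Borel–Jacquet 1979, 4.6; Tate 1950, §2.5).
* `automorphicInduction_character_cubic_iff_isAutomorphicInductionAlong` — **the fact through
  Def. 6.1**: `automorphicInduction_character_cubic` holds iff for every cubic `E/F`, every
  finite-order `θ` satisfying the fact's regularity hypothesis and every automorphic datum `τ` on
  `GL₁(𝔸_E)` with `t_{τ,w} = {θ(ϖ_w)}` a.e., there is a cuspidal `π` on `GL₃(𝔸_F)` automorphically
  induced from `τ` along `E/F` (`IsAutomorphicInductionAlong τ π.1`) — the shape of the cyclic
  fact `automorphicInduction_cyclic`, so that a source stated in that vocabulary discharges the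
  fact verbatim as well.

Nothing here discharges the fact (net debt unchanged); see the module docstrings of
`AutomorphicInductionCharacterCubic` and `AutomorphicInductionUnitaryCharacterCubic` for the
sources read (Gelbart 1997, pp. 244–245, 258 of the held copy; the primary JPSS 1979 is held as
an image scan only).

## References

* H. Jacquet, I. I. Piatetski-Shapiro, J. Shalika, *Automorphic forms on GL(3) II*, Ann. of Math.
  109 (1979), 213–258, §§13–14. [JacquetPiatetskishapiroShalika1979II]
* S. Gelbart, *Three lectures on the modularity of `ρ̄_{E,3}` and the Langlands reciprocity
  conjecture*, in: Modular Forms and Fermat's Last Theorem (1997), Thm. 5.3.1, Remarks 5.3.1 (a),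
  (e), §7.2. [Gelbart1997]
* J. Arthur, L. Clozel, *Simple algebras, base change, and the advanced theory of the trace
  formula*, Ann. of Math. Stud. 120 (1989), Ch. 3, §6, Def. 6.1, (6.1)–(6.2). [ArthurClozelAMS120]
* A. Borel, H. Jacquet, *Automorphic forms and automorphic representations*, Proc. Sympos. Pure
  Math. 33 (1979), part 1, §4.6. [BorelJacquet1979]
-/

noncomputable section

open scoped NumberField Polynomial Classical
open NumberField IsDedekindDomain Polynomial Filter Literature.NumberTheory.Automorphic

namespace Literature.NumberTheory.Automorphic

/-! ### Reduction to the unitary fact -/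

/-- **The finite-order cubic induction fact is the finite-order case of the unitary one.**
`automorphicInduction_unitaryCharacter_cubic` (Jacquet–Piatetski-Shapiro–Shalika 1979, §§13–14;
Gelbart 1997, Thm. 5.3.1 with Remark 5.3.1 (e), vendored for every unitary Hecke character of a
cubic, not necessarily Galois, `E/F`) implies `automorphicInduction_character_cubic`: its
cuspidality clause (2) has verbatim the regularity hypothesis and the conclusion of the
finite-order fact, and a Hecke character of finite order is unitary
(`HeckeCharacter.IsFiniteOrder.isUnitary`).  Hence `automorphicInduction_character_cubic_holds`
is this theorem applied to `automorphicInduction_unitaryCharacter_cubic_holds` once the latter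
exists. [cite: JacquetPiatetskishapiroShalika1979II, §§13–14] [cite: Gelbart1997, Thm. 5.3.1 and Remark 5.3.1 (e)] -/
theorem automorphicInduction_character_cubic_of_unitaryCharacter
    (h : automorphicInduction_unitaryCharacter_cubic) : automorphicInduction_character_cubic :=
  fun F E _ _ _ _ _ h3 θ hθ hreg hF => (h F E h3 θ hθ.isUnitary hF).2 hreg

/-! ### Def. 6.1 for `n = 1` is the character identity -/

section Along

variable {F E : Type} [Field F] [NumberField F] [Field E] [NumberField E] [Algebra F E]
  {N : ℕ} {hE : isCompact_glFiniteIntegralLevel 1 E} {hF : isCompact_glFiniteIntegralLevel N F}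

/-- **Def. 6.1 along `E/F` for a representation of `GL₁(𝔸_E)` with the Satake parameters of a
Hecke character.** Let `θ` be a Hecke character of `E` and `τ` an automorphic representation datum
of `GL₁(𝔸_E)` with Satake parameter `{θ(ϖ_w)}` at all but finitely many `w` (e.g. `π_θ`,
`exists_automorphicRepData_hasSatakeParamAt_valueAtUniformizer`). Then an automorphic
representation `π` of `GL_N(𝔸_F)` is a weak automorphic induction of `τ` along `E/F`
(Arthur–Clozel 1989, Ch. 3, Def. 6.1: at almost every `v`, `t_{π,v}` is the multiset of
`f(w|v)`-th roots of the `t_{τ,w}`, `w ∣ v`) iff, for almost every finite place `v` of `F`, `π`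
has a Satake parameter `α` at `v` with `∏_{a ∈ α} (X - a) = ∏_{w ∣ v} (X^{f(w|v)} - θ(ϖ_w))`, the
local identity of `automorphicInduction_character(_cubic)`. No hypothesis on `E/F` or `N`.
Forward: feed Def. 6.1 with `β_w = {θ(ϖ_w)}`, available at every `w ∣ v` for almost every `v`
(`eventually_forall_under_eq`); backward: any admissible family `β` agrees with `{θ(ϖ_w)}` above
`v` by uniqueness of Satake parameters (`AutomorphicRepData.hasSatakeParamAt_unique_holds`).
[cite: ArthurClozelAMS120, Ch. 3 Def. 6.1 and (6.1)–(6.2)] -/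
theorem isAutomorphicInductionAlong_iff_of_hasSatakeParamAt_singleton
    (θ : GaloisRepresentations.HeckeCharacter E)
    {τ : AutomorphicRepData (AutomorphyDatum.gl 1 E hE)}
    (hτ : ∀ᶠ w : HeightOneSpectrum (𝓞 E) in cofinite,
      τ.HasSatakeParamAt w {θ.valueAtUniformizer w})
    (π : AutomorphicRepData (AutomorphyDatum.gl N F hF)) :
    IsAutomorphicInductionAlong τ π ↔
      ∀ᶠ v : HeightOneSpectrum (𝓞 F) in cofinite, ∃ α : Multiset ℂ,
        π.HasSatakeParamAt v α ∧
          satakePolynomial α =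
            ∏ᶠ w ∈ {w : HeightOneSpectrum (𝓞 E) | w.under (𝓞 F) = v},
              (X ^ w.asIdeal.inertiaDeg (𝓞 F) - C (θ.valueAtUniformizer w)) := by
  have hτ' := eventually_forall_under_eq (F := F) hτ
  constructor
  · intro h
    filter_upwards [h, hτ'] with v hv hτv
    obtain ⟨α, hα, hαβ⟩ := hv (fun w => {θ.valueAtUniformizer w}) hτv
    exact ⟨α, hα, hαβ.trans (finprod_under_eq_inducedSatakePolynomial _ v).symm⟩
  · intro h
    filter_upwards [h, hτ'] with v hv hτv β hβ
    obtain ⟨α, hα, hαθ⟩ := hv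
    refine ⟨α, hα, hαθ.trans ?_⟩
    exact (finprod_under_eq_inducedSatakePolynomial (fun w => θ.valueAtUniformizer w) v).trans
      (inducedSatakePolynomial_congr v fun w hw =>
        τ.hasSatakeParamAt_unique_holds (hτv w hw) (hβ w hw))

/-- **The automorphic representation `π_θ` of `GL₁(𝔸_E)` of a Hecke character has Satake
parameter `{θ(ϖ_w)}` at almost every `w`** (Borel–Jacquet 1979, 4.6; Tate 1950, §2.5): the datum
`ℂ·(θ∘det)/⊥` of `exists_automorphicRepData_detTwist_glOne`, at every `w` prime to a level `𝔪` of
`θ` (`HeckeCharacter.exists_level_glOne`; all but finitely many `w`, `Ideal.finite_factors`), for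
the tree's chosen uniformizer `ϖ_w` (`HeckeCharacter.uniformizer`, so that the parameter is
literally `HeckeCharacter.valueAtUniformizer`). [cite: BorelJacquet1979, 4.6] -/
theorem exists_automorphicRepData_hasSatakeParamAt_valueAtUniformizer
    (hE : isCompact_glFiniteIntegralLevel 1 E) (θ : GaloisRepresentations.HeckeCharacter E) :
    ∃ τ : AutomorphicRepData (AutomorphyDatum.gl 1 E hE),
      ∀ᶠ w : HeightOneSpectrum (𝓞 E) in cofinite,
        τ.HasSatakeParamAt w {θ.valueAtUniformizer w} := by
  obtain ⟨τ, hW, hW'⟩ := exists_automorphicRepData_detTwist_glOne hE θ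
  obtain ⟨𝔪, h𝔪, hθ𝔪⟩ := GaloisRepresentations.HeckeCharacter.exists_level_glOne θ
  refine ⟨τ, ?_⟩
  have hcof : ∀ᶠ w : HeightOneSpectrum (𝓞 E) in cofinite, ¬ w.asIdeal ∣ 𝔪 :=
    (Ideal.finite_factors h𝔪).compl_mem_cofinite
  filter_upwards [hcof] with w hw
  exact AutomorphicRepData.hasSatakeParamAt_detTwist_glOne hE hW hW' h𝔪 hθ𝔪 w hw
    (GaloisRepresentations.HeckeCharacter.valued_uniformizer (K := E) w)

end Along

/-! ### The named fact through Def. 6.1 -/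

/-- **Non-normal cubic automorphic induction of a Hecke character, in the vocabulary of
Arthur–Clozel's Def. 6.1.** The named fact `automorphicInduction_character_cubic`
(Jacquet–Piatetski-Shapiro–Shalika 1979, §§13–14; Gelbart 1997, Thm. 5.3.1 with Remark 5.3.1 (e))
holds iff: for every extension of number fields `E/F` of degree `3` (not assumed Galois), every
Hecke character `θ` of `E` of finite order satisfying the fact's regularity hypothesis (two places
`w ≠ w'` above one `v`, of the same residue degree, unramified for `θ`, with
`θ(ϖ_w) ≠ θ(ϖ_{w'})`), and every automorphic representation datum `τ` of `GL₁(𝔸_E)` with Satake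
parameters `{θ(ϖ_w)}` almost everywhere, there is a **cuspidal** automorphic representation `π` of
`GL₃(𝔸_F)` automorphically induced from `τ` along `E/F` in the weak sense
(`IsAutomorphicInductionAlong τ π.1`: `det(X - t_{π,v}) = ∏_{w ∣ v} (X^{f(w|v)} - θ(ϖ_w))` for
almost all `v`). Forward through `isAutomorphicInductionAlong_iff_of_hasSatakeParamAt_singleton`;
backward with the datum `π_θ` (`exists_automorphicRepData_hasSatakeParamAt_valueAtUniformizer`,
typed by the proved compactness fact `isCompact_glFiniteIntegralLevel_holds 1 E`). This is the
shape in which a source for the fact is to be consumed (compare `automorphicInduction_cyclic`).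
[cite: JacquetPiatetskishapiroShalika1979II, §§13–14] [cite: Gelbart1997, Thm. 5.3.1 and Remark 5.3.1 (e)] -/
theorem automorphicInduction_character_cubic_iff_isAutomorphicInductionAlong :
    automorphicInduction_character_cubic ↔
      ∀ (F E : Type) [Field F] [NumberField F] [Field E] [NumberField E] [Algebra F E],
        Module.finrank F E = 3 →
        ∀ (θ : GaloisRepresentations.HeckeCharacter E), θ.IsFiniteOrder →
          (∃ (v : HeightOneSpectrum (𝓞 F)) (w w' : HeightOneSpectrum (𝓞 E)), w ≠ w' ∧
              w.under (𝓞 F) = v ∧ w'.under (𝓞 F) = v ∧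
              w.asIdeal.inertiaDeg (𝓞 F) = w'.asIdeal.inertiaDeg (𝓞 F) ∧
              θ.IsUnramifiedAt w ∧ θ.IsUnramifiedAt w' ∧
              θ.valueAtUniformizer w ≠ θ.valueAtUniformizer w') →
          ∀ (hE : isCompact_glFiniteIntegralLevel 1 E) (hF : isCompact_glFiniteIntegralLevel 3 F)
            (τ : AutomorphicRepData (AutomorphyDatum.gl 1 E hE)),
            (∀ᶠ w : HeightOneSpectrum (𝓞 E) in cofinite,
                τ.HasSatakeParamAt w {θ.valueAtUniformizer w}) →
              ∃ π : CuspidalAutomorphicRepData 3 F hF, IsAutomorphicInductionAlong τ π.1 := by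
  constructor
  · intro h F E _ _ _ _ _ h3 θ hθ hreg hE hF τ hτ
    obtain ⟨π, hπ⟩ := h F E h3 θ hθ hreg hF
    exact ⟨π, (isAutomorphicInductionAlong_iff_of_hasSatakeParamAt_singleton θ hτ π.1).2 hπ⟩
  · intro h F E _ _ _ _ _ h3 θ hθ hreg hF
    obtain ⟨τ, hτ⟩ := exists_automorphicRepData_hasSatakeParamAt_valueAtUniformizer
      (isCompact_glFiniteIntegralLevel_holds 1 E) θ
    obtain ⟨π, hπ⟩ := h F E h3 θ hθ hreg _ hF τ hτ
    exact ⟨π, (isAutomorphicInductionAlong_iff_of_hasSatakeParamAt_singleton θ hτ π.1).1 hπ⟩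

end Literature.NumberTheory.Automorphic

end
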